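import Literature.AlgebraicGeometry.Motives.AmpleDivisorBoxProduct
import Literature.AlgebraicGeometry.Motives.AbelianVarietyWeilPairingPullback
import Literature.AlgebraicGeometry.Motives.AbelianVarietyWeilPairingDivisorClass
import Literature.AlgebraicGeometry.Motives.AbelianVarietyWeilPairingBiprod
import HarnessLib

/-!
# The box product `∑_c pr_c^* Θ_c` of ample divisors on a finite biproduct of abelian varieties

Layer `Literature/AlgebraicGeometry/Motives`, namespace `Literature.AlgebraicGeometry.Motives.AbelianVariety`.
KERNEL ONLY: theorems; no definition, no named fact, no instance, no `sorry` (net debt 0).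

For a finite non-empty family `J_c` of abelian varieties over a field `K` with ample Cartier divisors `Θ_c` and ANY
biproduct presentation `(Y, π_c : Y → J_c, ι_c : J_c → Y)` (`ι_c π_c = 1`, `ι_c π_{c'} = 0` for `c ≠ c'`,
`∑_c π_c ι_c = 1`) there is an AMPLE Cartier divisor `Θ'` on `Y` — a presentation of the box product
`⊠_c Θ_c = ∑_c π_c^* Θ_c` (EGA II 4.6.13 (iv); Görtz–Wedhorn I, Prop. 13.50 (4); the product polarisation, Lange
§2.1.1 / Exercise 2.6 (3)) — whose level-`N` Weil pairing is the product of the factors' pairings,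
`ē_N^{Θ'}(P, Q) = ∏_c ē_N^{Θ_c}(π_c P, π_c Q)` (Mumford §20 (3); Lang VII §2 Prop. 3), so that `(π_c, ι_c)` are
level-adjoint pairs of weight `1` for `(Θ', Θ_c)`: `ē^{Θ'}(P, ι_c Q) = ē^{Θ_c}(π_c P, Q)`.

The tree's `CartierDivisor` has `+` but no `Finset.sum` (presentations are not quotiented) and the category of
abelian varieties has binary biproducts only (`Motives/AbelianVarietyProduct`); hence the `∃ Θ'` form, proved by
`Fintype.induction_empty_option` from the BINARY ★ `AbelianVariety.isAmple_boxProduct` on `Y₁ ×_K J`,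
★ `weilPairingLevel_add` / ★ `weilPairingLevel_pullback`, and transported to an arbitrary presentation along the
isomorphism `∑_c π_c ι⁰_c` (★ `CartierDivisor.IsAmple.pullback`: an isomorphism is affine and dominant).

* `isDominant_toSchemeHom_zsmul_id_of_comp_eq_id` — `[N]` is dominant on a direct factor if it is on the whole.
* `exists_biproduct_isAmple_weilPairingLevel_eq_prod` — SOME biproduct of the `J_c` carries such a `Θ'`.
* `exists_isAmple_weilPairingLevel_eq_prod_of_biproduct` — ANY biproduct presentation `(Y, π, ι)` does.
* `weilPairingLevel_map_ι_right_of_prod_law` / `…_left_…` — the level-adjoint identities of the legs.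

## References
* [GortzWedhorn2020] U. Görtz, T. Wedhorn, *Algebraic Geometry I*, 2nd ed. (2020), Prop. 13.50 (4) (p. 394),
  Prop. 13.66 (2) (p. 402), Prop. 4.32 (2) (p. 137).
* [EGAII] A. Grothendieck, *Éléments de géométrie algébrique II*, Publ. Math. IHÉS 8 (1961), Prop. 4.6.13 (iv).
* [MumfordAV1970] D. Mumford, *Abelian Varieties* (1970), §19 (p. 169), §20 property (3) of `e_n` (p. 186).
* [Lang1983AbelianVarieties] S. Lang, *Abelian Varieties*, Ch. VII §2, Props. 2–3.
* [Lange2023AbelianVarietiesComplex] H. Lange, *Abelian Varieties over the Complex Numbers* (2023), §2.1.1, Ex. 2.6 (3).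
-/

noncomputable section

universe u v

open CategoryTheory CategoryTheory.Limits AlgebraicGeometry

namespace Literature.AlgebraicGeometry.Motives

namespace AbelianVariety

variable {K : Type u} [Field K]

/-! ### §0 Dominance of `[N]` on a direct factor; isomorphisms; points under `0` and composites -/

/-- **`[N]` is dominant on a direct factor**: if `s ≫ p = 𝟙 Z` (so `p : Y → Z` is a split epimorphism) and
`[N]_Y` is dominant then `[N]_Z` is dominant, since `[N]_Y ≫ p = p ≫ [N]_Z` is dominant (Mumford §19: homomorphisms
commute with `[N]`; Görtz–Wedhorn I, Prop. 4.32 (2)). [cite: MumfordAV1970, §19 (first paragraph)] -/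
theorem isDominant_toSchemeHom_zsmul_id_of_comp_eq_id {Y Z : AbelianVariety K} (p : Y ⟶ Z) (s : Z ⟶ Y)
    (h : s ≫ p = 𝟙 Z) (N : ℤ) [IsDominant (Hom.toSchemeHom (N • 𝟙 Y))] :
    IsDominant (Hom.toSchemeHom (N • 𝟙 Z)) := by
  haveI : IsDominant (Hom.toSchemeHom p) := isDominant_toSchemeHom_of_comp_eq_id p s h
  haveI : IsDominant (Hom.toSchemeHom (N • 𝟙 Y) ≫ Hom.toSchemeHom p) := inferInstance
  have hc : Hom.toSchemeHom (N • 𝟙 Y) ≫ Hom.toSchemeHom p = Hom.toSchemeHom p ≫ Hom.toSchemeHom (N • 𝟙 Z) := by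
    change Hom.toSchemeHom ((N • 𝟙 Y) ≫ p) = Hom.toSchemeHom (p ≫ (N • 𝟙 Z))
    rw [Preadditive.zsmul_comp, Preadditive.comp_zsmul, Category.id_comp, Category.comp_id]
  haveI : IsDominant (Hom.toSchemeHom p ≫ Hom.toSchemeHom (N • 𝟙 Z)) := by rw [← hc]; infer_instance
  exact IsDominant.of_comp (Hom.toSchemeHom p) (Hom.toSchemeHom (N • 𝟙 Z))

/-- The underlying scheme morphism of an isomorphism of abelian varieties is an isomorphism. [folklore] -/
private theorem biprodPres_isIso_toSchemeHom {Y Z : AbelianVariety K} (φ : Y ≅ Z) : IsIso (Hom.toSchemeHom φ.hom) :=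
  ⟨Hom.toSchemeHom φ.inv, by
    constructor
    · change Hom.toSchemeHom (φ.hom ≫ φ.inv) = _; rw [φ.hom_inv_id]; rfl
    · change Hom.toSchemeHom (φ.inv ≫ φ.hom) = _; rw [φ.inv_hom_id]; rfl⟩

/-- The zero homomorphism sends every point to the identity point. [folklore] -/
private theorem biprodPres_map_zero_apply {A B : AbelianVariety K} (Q : A.Points K) :
    AlgPoints.map (0 : A ⟶ B).hom.hom.hom Q = 1 := by
  unfold AlgPoints.map
  rw [hom_zero]; simp

/-- Points are functorial in composites of homomorphisms. [folklore] -/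
private theorem biprodPres_map_comp_apply {A B C : AbelianVariety K} (f : A ⟶ B) (g : B ⟶ C) (Q : A.Points K) :
    AlgPoints.map (f ≫ g).hom.hom.hom Q = AlgPoints.map g.hom.hom.hom (AlgPoints.map f.hom.hom.hom Q) := by
  change AlgPoints.map (f.hom.hom.hom ≫ g.hom.hom.hom) Q = _
  exact AlgPoints.map_comp_apply _ _ _

/-- The identity homomorphism fixes every point. [folklore] -/
private theorem biprodPres_map_id_apply {A : AbelianVariety K} (Q : A.Points K) :
    AlgPoints.map (𝟙 A : A ⟶ A).hom.hom.hom Q = Q := by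
  unfold AlgPoints.map
  simp

/-- **Orthogonality calculus of a biproduct presentation**: `(∑_c f_c ι_c)(∑_c π_c g_c) = ∑_c f_c g_c` when
`ι_c π_c = 1` and `ι_c π_{c'} = 0` (`c ≠ c'`). [folklore] -/
private theorem biprodPres_sum_comp_sum {C : Type v} [Fintype C] {J : C → AbelianVariety K}
    {Y T T' : AbelianVariety K} (π : ∀ c, Y ⟶ J c) (ι : ∀ c, J c ⟶ Y) (h₁ : ∀ c, ι c ≫ π c = 𝟙 (J c))
    (h₂ : ∀ c c', c ≠ c' → ι c ≫ π c' = 0) (f : ∀ c, T ⟶ J c) (g : ∀ c, J c ⟶ T') :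
    (∑ c, f c ≫ ι c) ≫ (∑ c, π c ≫ g c) = ∑ c, f c ≫ g c := by
  classical
  rw [Preadditive.sum_comp]
  refine Finset.sum_congr rfl fun c _ => ?_
  rw [Preadditive.comp_sum, Finset.sum_eq_single c]
  · rw [Category.assoc, ← Category.assoc (ι c), h₁, Category.id_comp]
  · intro c' _ hc'; rw [Category.assoc, ← Category.assoc (ι c), h₂ c c' (Ne.symm hc'), zero_comp, comp_zero]
  · intro hc; exact absurd (Finset.mem_univ c) hc

/-- `(∑_{c'} f_{c'} ι_{c'}) π_c = f_c`. [folklore] -/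
private theorem biprodPres_sum_comp_π {C : Type v} [Fintype C] {J : C → AbelianVariety K}
    {Y T : AbelianVariety K} (π : ∀ c, Y ⟶ J c) (ι : ∀ c, J c ⟶ Y) (h₁ : ∀ c, ι c ≫ π c = 𝟙 (J c))
    (h₂ : ∀ c c', c ≠ c' → ι c ≫ π c' = 0) (f : ∀ c, T ⟶ J c) (c : C) :
    (∑ c', f c' ≫ ι c') ≫ π c = f c := by
  classical
  rw [Preadditive.sum_comp, Finset.sum_eq_single c]
  · rw [Category.assoc, h₁, Category.comp_id]
  · intro c' _ hc'; rw [Category.assoc, h₂ c' c hc', comp_zero]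
  · intro hc; exact absurd (Finset.mem_univ c) hc

/-! ### §1 Some biproduct of the `J_c` carries an ample box product with the product pairing law
(`Fintype.induction_empty_option`; the inductive statement is spelled out in full each time — no definition is filed) -/

section Existence

/-- Induction step `C ↦ Option C` (non-empty `C`): from a presentation `(Y₁, π₁, ι₁, Θ₁)` for the `J (some a)` to
`Y = Y₁ ×_K J(none)` with the legs through `fst`/`snd`/`prodLift` and `Θ' = fst^* Θ₁ + snd^* Θ_{none}` — ample by the
BINARY box product ★ `isAmple_boxProduct`; the pairing law by ★ `weilPairingLevel_add` and ★ `weilPairingLevel_pullback`.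
[cite: GortzWedhorn2020, Prop. 13.50 (4) (p. 394)] [cite: MumfordAV1970, §20 (property (3) of e_n, p. 186)] -/
private theorem biprodPres_exists_model_option {C : Type v} [Fintype C] (J : Option C → AbelianVariety K)
    (Θ : ∀ o, CartierDivisor (J o).X.left) (hΘ : ∀ o, (Θ o).IsAmple)
    (Y₁ : AbelianVariety K) (π₁ : ∀ a, Y₁ ⟶ J (some a)) (ι₁ : ∀ a, J (some a) ⟶ Y₁)
    (h₁ : ∀ a, ι₁ a ≫ π₁ a = 𝟙 _) (h₂ : ∀ a a', a ≠ a' → ι₁ a ≫ π₁ a' = 0) (h₃ : ∑ a, π₁ a ≫ ι₁ a = 𝟙 Y₁)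
    (Θ₁ : CartierDivisor Y₁.X.left) (hΘ₁ : Θ₁.IsAmple)
    (hlaw₁ : ∀ (N : ℕ) [IsDominant (Hom.toSchemeHom ((N : ℤ) • 𝟙 Y₁))]
      [∀ a, IsDominant (Hom.toSchemeHom ((N : ℤ) • 𝟙 (J (some a))))] (P Q : Y₁.torsionPoints K N),
      Y₁.weilPairingLevel Θ₁ P Q = ∏ a, (J (some a)).weilPairingLevel (Θ (some a)) ⟨AlgPoints.map (π₁ a).hom.hom.hom P.1,
        map_mem_torsionPoints (π₁ a) P.2⟩ ⟨AlgPoints.map (π₁ a).hom.hom.hom Q.1, map_mem_torsionPoints (π₁ a) Q.2⟩) :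
    ∃ (Y : AbelianVariety K) (π : ∀ o, Y ⟶ J o) (ι : ∀ o, J o ⟶ Y),
      (∀ o, ι o ≫ π o = 𝟙 (J o)) ∧ (∀ o o', o ≠ o' → ι o ≫ π o' = 0) ∧ (∑ o, π o ≫ ι o = 𝟙 Y) ∧
      ∃ Θ' : CartierDivisor Y.X.left, Θ'.IsAmple ∧
        ∀ (N : ℕ) [IsDominant (Hom.toSchemeHom ((N : ℤ) • 𝟙 Y))]
          [∀ o, IsDominant (Hom.toSchemeHom ((N : ℤ) • 𝟙 (J o)))] (P Q : Y.torsionPoints K N),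
          Y.weilPairingLevel Θ' P Q = ∏ o, (J o).weilPairingLevel (Θ o) ⟨AlgPoints.map (π o).hom.hom.hom P.1,
            map_mem_torsionPoints (π o) P.2⟩ ⟨AlgPoints.map (π o).hom.hom.hom Q.1, map_mem_torsionPoints (π o) Q.2⟩ := by
  classical
  refine ⟨Y₁.prod (J none),
    fun o => match o with
      | none => snd Y₁ (J none)
      | some a => fst Y₁ (J none) ≫ π₁ a,
    fun o => match o with
      | none => prodLift 0 (𝟙 (J none))
      | some a => ι₁ a ≫ prodLift (𝟙 Y₁) 0,
    ?_, ?_, ?_, ?_⟩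
  · rintro (_ | a)
    · exact prodLift_snd _ _
    · change (ι₁ a ≫ prodLift (𝟙 Y₁) 0) ≫ fst Y₁ (J none) ≫ π₁ a = 𝟙 _
      rw [Category.assoc, ← Category.assoc (prodLift _ _), prodLift_fst, Category.id_comp, h₁]
  · rintro (_ | a) (_ | a') hne
    · exact absurd rfl hne
    · change prodLift 0 (𝟙 (J none)) ≫ fst Y₁ (J none) ≫ π₁ a' = 0
      rw [← Category.assoc, prodLift_fst, zero_comp]
    · change (ι₁ a ≫ prodLift (𝟙 Y₁) 0) ≫ snd Y₁ (J none) = 0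
      rw [Category.assoc, prodLift_snd, comp_zero]
    · change (ι₁ a ≫ prodLift (𝟙 Y₁) 0) ≫ fst Y₁ (J none) ≫ π₁ a' = 0
      rw [Category.assoc, ← Category.assoc (prodLift _ _), prodLift_fst, Category.id_comp,
        h₂ a a' (fun h => hne (congrArg some h))]
  · rw [Fintype.sum_option]
    change snd Y₁ (J none) ≫ prodLift 0 (𝟙 (J none)) +
        ∑ a, (fst Y₁ (J none) ≫ π₁ a) ≫ ι₁ a ≫ prodLift (𝟙 Y₁) 0 = 𝟙 _
    have hre : ∀ a, (fst Y₁ (J none) ≫ π₁ a) ≫ ι₁ a ≫ prodLift (𝟙 Y₁) (0 : Y₁ ⟶ J none) =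
        fst Y₁ (J none) ≫ ((π₁ a ≫ ι₁ a) ≫ prodLift (𝟙 Y₁) (0 : Y₁ ⟶ J none)) := fun a => by simp only [Category.assoc]
    rw [Finset.sum_congr rfl fun a _ => hre a, ← Preadditive.comp_sum, ← Preadditive.sum_comp, h₃, Category.id_comp]
    apply prod_hom_ext
    · rw [Preadditive.add_comp, Category.assoc, Category.assoc, prodLift_fst, prodLift_fst, comp_zero, zero_add,
        Category.comp_id, Category.id_comp]
    · rw [Preadditive.add_comp, Category.assoc, Category.assoc, prodLift_snd, prodLift_snd, comp_zero, add_zero,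
        Category.comp_id, Category.id_comp]
  · haveI := isDominant_fst_left Y₁ (J none)
    haveI := isDominant_snd_left Y₁ (J none)
    refine ⟨Θ₁.pullback (Hom.toSchemeHom (fst Y₁ (J none))) +
        (Θ none).pullback (Hom.toSchemeHom (snd Y₁ (J none))), isAmple_boxProduct Y₁ (J none) hΘ₁ (hΘ none), ?_⟩
    intro N _ hJ P Q
    haveI : IsDominant (Hom.toSchemeHom ((N : ℤ) • 𝟙 Y₁)) :=
      isDominant_toSchemeHom_zsmul_id_of_comp_eq_id (fst Y₁ (J none)) (prodLift (𝟙 Y₁) 0) (prodLift_fst _ _) N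
    haveI : IsDominant (Hom.toSchemeHom ((N : ℤ) • 𝟙 (J none))) := hJ none
    rw [weilPairingLevel_add, weilPairingLevel_pullback, weilPairingLevel_pullback, hlaw₁ N, Fintype.prod_option,
      mul_comm]
    refine congrArg₂ (· * ·) rfl (Finset.prod_congr rfl fun a _ => ?_)
    congr 1

/-- Transport of a presentation along a bijection of index types `e : α ≃ β` (the `of_equiv` obligation of
`Fintype.induction_empty_option`): the legs are re-indexed through `eqToHom` along `J (e (e.symm b)) = J b`;
`Y` and `Θ'` are unchanged. [folklore] -/
private theorem biprodPres_exists_model_equiv {α β : Type v} [Fintype α] [Fintype β] (e : α ≃ β) (J : β → AbelianVariety K)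
    (Θ : ∀ b, CartierDivisor (J b).X.left) (Y : AbelianVariety K) (π : ∀ a, Y ⟶ J (e a)) (ι : ∀ a, J (e a) ⟶ Y)
    (h₁ : ∀ a, ι a ≫ π a = 𝟙 _) (h₂ : ∀ a a', a ≠ a' → ι a ≫ π a' = 0) (h₃ : ∑ a, π a ≫ ι a = 𝟙 Y)
    (Θ' : CartierDivisor Y.X.left)
    (hlaw : ∀ (N : ℕ) [IsDominant (Hom.toSchemeHom ((N : ℤ) • 𝟙 Y))]
      [∀ a, IsDominant (Hom.toSchemeHom ((N : ℤ) • 𝟙 (J (e a))))] (P Q : Y.torsionPoints K N),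
      Y.weilPairingLevel Θ' P Q = ∏ a, (J (e a)).weilPairingLevel (Θ (e a)) ⟨AlgPoints.map (π a).hom.hom.hom P.1,
        map_mem_torsionPoints (π a) P.2⟩ ⟨AlgPoints.map (π a).hom.hom.hom Q.1, map_mem_torsionPoints (π a) Q.2⟩) :
    ∃ (π' : ∀ b, Y ⟶ J b) (ι' : ∀ b, J b ⟶ Y),
      (∀ b, ι' b ≫ π' b = 𝟙 (J b)) ∧ (∀ b b', b ≠ b' → ι' b ≫ π' b' = 0) ∧ (∑ b, π' b ≫ ι' b = 𝟙 Y) ∧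
        ∀ (N : ℕ) [IsDominant (Hom.toSchemeHom ((N : ℤ) • 𝟙 Y))]
          [∀ b, IsDominant (Hom.toSchemeHom ((N : ℤ) • 𝟙 (J b)))] (P Q : Y.torsionPoints K N),
          Y.weilPairingLevel Θ' P Q = ∏ b, (J b).weilPairingLevel (Θ b) ⟨AlgPoints.map (π' b).hom.hom.hom P.1,
            map_mem_torsionPoints (π' b) P.2⟩ ⟨AlgPoints.map (π' b).hom.hom.hom Q.1, map_mem_torsionPoints (π' b) Q.2⟩ := by
  classical
  have hπ : ∀ (a a' : α) (_ : a' = a) (p : J (e a') = J (e a)), π a' ≫ eqToHom p = π a := by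
    rintro a _ rfl p; simp
  refine ⟨fun b => π (e.symm b) ≫ eqToHom (congrArg J (e.apply_symm_apply b)),
    fun b => eqToHom (congrArg J (e.apply_symm_apply b)).symm ≫ ι (e.symm b), ?_, ?_, ?_, ?_⟩
  · intro b
    rw [Category.assoc, ← Category.assoc (ι _), h₁, Category.id_comp, eqToHom_trans, eqToHom_refl]
  · intro b b' hne
    rw [Category.assoc, ← Category.assoc (ι _), h₂ _ _ (fun h => hne (e.symm.injective h)), zero_comp, comp_zero]
  · have hre : ∀ b, (π (e.symm b) ≫ eqToHom (congrArg J (e.apply_symm_apply b))) ≫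
        (eqToHom (congrArg J (e.apply_symm_apply b)).symm ≫ ι (e.symm b)) = π (e.symm b) ≫ ι (e.symm b) := by
      intro b
      rw [Category.assoc, ← Category.assoc (eqToHom _), eqToHom_trans, eqToHom_refl, Category.id_comp]
    rw [Finset.sum_congr rfl fun b _ => hre b, ← h₃]
    exact Fintype.sum_equiv e.symm _ _ (fun b => rfl)
  · intro N _ hJ P Q
    haveI : ∀ a, IsDominant (Hom.toSchemeHom ((N : ℤ) • 𝟙 (J (e a)))) := fun a => hJ (e a)
    rw [hlaw N P Q]
    refine Fintype.prod_equiv e _ _ fun a => ?_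
    simp only [hπ a (e.symm (e a)) (e.symm_apply_apply a)]

/-- **Some biproduct of the `J_c` carries an ample box product with the product pairing law**: for a non-empty
finite family of abelian varieties `J_c` with ample `Θ_c` there are a biproduct presentation `(Y, π_c, ι_c)` and an
ample Cartier divisor `Θ'` on `Y` (a presentation of `∑_c π_c^* Θ_c`) with
`ē_N^{Θ'}(P, Q) = ∏_c ē_N^{Θ_c}(π_c P, π_c Q)` for all `N` and all `N`-torsion points `P, Q` of `Y`
(EGA II 4.6.13 (iv) / Görtz–Wedhorn I 13.50 (4) iterated; Mumford §20 (3)).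
[cite: GortzWedhorn2020, Prop. 13.50 (4) (p. 394)] [cite: EGAII, Prop. 4.6.13 (iv)] [cite: MumfordAV1970, §20 (property (3) of e_n, p. 186)] -/
theorem exists_biproduct_isAmple_weilPairingLevel_eq_prod {C : Type v} [Fintype C] [Nonempty C]
    (J : C → AbelianVariety K) (Θ : ∀ c, CartierDivisor (J c).X.left) (hΘ : ∀ c, (Θ c).IsAmple) :
    ∃ (Y : AbelianVariety K) (π : ∀ c, Y ⟶ J c) (ι : ∀ c, J c ⟶ Y),
      (∀ c, ι c ≫ π c = 𝟙 (J c)) ∧ (∀ c c', c ≠ c' → ι c ≫ π c' = 0) ∧ (∑ c, π c ≫ ι c = 𝟙 Y) ∧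
      ∃ Θ' : CartierDivisor Y.X.left, Θ'.IsAmple ∧
        ∀ (N : ℕ) [IsDominant (Hom.toSchemeHom ((N : ℤ) • 𝟙 Y))]
          [∀ c, IsDominant (Hom.toSchemeHom ((N : ℤ) • 𝟙 (J c)))] (P Q : Y.torsionPoints K N),
          Y.weilPairingLevel Θ' P Q = ∏ c, (J c).weilPairingLevel (Θ c)
            ⟨AlgPoints.map (π c).hom.hom.hom P.1, map_mem_torsionPoints (π c) P.2⟩
            ⟨AlgPoints.map (π c).hom.hom.hom Q.1, map_mem_torsionPoints (π c) Q.2⟩ := by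
  classical
  have main := Fintype.induction_empty_option
    (P := fun (α : Type v) (_ : Fintype α) => Nonempty α → ∀ (J : α → AbelianVariety K)
      (Θ : ∀ c, CartierDivisor (J c).X.left), (∀ c, (Θ c).IsAmple) →
      ∃ (Y : AbelianVariety K) (π : ∀ c, Y ⟶ J c) (ι : ∀ c, J c ⟶ Y),
        (∀ c, ι c ≫ π c = 𝟙 (J c)) ∧ (∀ c c', c ≠ c' → ι c ≫ π c' = 0) ∧ (∑ c, π c ≫ ι c = 𝟙 Y) ∧
        ∃ Θ' : CartierDivisor Y.X.left, Θ'.IsAmple ∧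
          ∀ (N : ℕ) [IsDominant (Hom.toSchemeHom ((N : ℤ) • 𝟙 Y))]
            [∀ c, IsDominant (Hom.toSchemeHom ((N : ℤ) • 𝟙 (J c)))] (P Q : Y.torsionPoints K N),
            Y.weilPairingLevel Θ' P Q = ∏ c, (J c).weilPairingLevel (Θ c) ⟨AlgPoints.map (π c).hom.hom.hom P.1,
              map_mem_torsionPoints (π c) P.2⟩ ⟨AlgPoints.map (π c).hom.hom.hom Q.1, map_mem_torsionPoints (π c) Q.2⟩)
    ?_ ?_ ?_ C
  · exact main ‹Nonempty C› J Θ hΘ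
  · -- re-indexing along `α ≃ β`
    intro α β _ e hα hβ J Θ hΘ
    letI : Fintype α := Fintype.ofEquiv β e.symm
    obtain ⟨Y, π, ι, h₁, h₂, h₃, Θ', hΘ', hlaw⟩ :=
      hα (hβ.map e.symm) (fun a => J (e a)) (fun a => Θ (e a)) (fun a => hΘ (e a))
    obtain ⟨π', ι', h₁', h₂', h₃', hlaw'⟩ := biprodPres_exists_model_equiv e J Θ Y π ι h₁ h₂ h₃ Θ' hlaw
    exact ⟨Y, π', ι', h₁', h₂', h₃', Θ', hΘ', hlaw'⟩
  · -- the empty family: excluded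
    intro h
    exact absurd h (not_nonempty_iff.mpr inferInstance)
  · -- `α ↦ Option α`
    intro α _ hα _ J Θ hΘ
    rcases isEmpty_or_nonempty α with hE | hN
    · -- a single factor: `Y = J none`
      refine ⟨J none, fun o => match o with
          | none => 𝟙 (J none)
          | some a => isEmptyElim a,
        fun o => match o with
          | none => 𝟙 (J none)
          | some a => isEmptyElim a, ?_, ?_, ?_, Θ none, hΘ none, ?_⟩
      · rintro (_ | a); exacts [Category.comp_id _, isEmptyElim a]
      · rintro (_ | a) (_ | a') hne
        · exact absurd rfl hne
        all_goals first | exact isEmptyElim a | exact isEmptyElim a'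
      · rw [Fintype.sum_option, Fintype.sum_empty, add_zero]; exact Category.comp_id _
      · intro N _ _ P Q
        rw [Fintype.prod_option, Fintype.prod_empty, mul_one]
        change (J none).weilPairingLevel (Θ none) P Q = (J none).weilPairingLevel (Θ none) _ _
        congr 1
    · obtain ⟨Y₁, π₁, ι₁, h₁, h₂, h₃, Θ₁, hΘ₁, hlaw₁⟩ := hα hN (fun a => J (some a)) (fun a => Θ (some a)) fun a => hΘ (some a)
      exact biprodPres_exists_model_option J Θ hΘ Y₁ π₁ ι₁ h₁ h₂ h₃ Θ₁ hΘ₁ hlaw₁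

end Existence

/-! ### §2 ANY biproduct presentation carries an ample box product with the product pairing law -/

/-- **The box product on an arbitrary biproduct presentation.**  For a non-empty finite family of abelian
varieties `J_c` with ample `Θ_c` and ANY presentation `(Y, π_c, ι_c)` of their biproduct (`ι_c π_c = 1`,
`ι_c π_{c'} = 0` for `c ≠ c'`, `∑_c π_c ι_c = 1`) there is an ample Cartier divisor `Θ'` on `Y` with
`ē_N^{Θ'}(P, Q) = ∏_c ē_N^{Θ_c}(π_c P, π_c Q)` for every `N` and all `N`-torsion points `P, Q` of `Y` (transport of
`exists_biproduct_isAmple_weilPairingLevel_eq_prod` along the isomorphism `φ = ∑_c π_c ι⁰_c : Y ≅ Y⁰`, `Θ' = φ^* Θ⁰`;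
EGA II 4.6.13 (iv); Görtz–Wedhorn I, Prop. 13.50 (4) and 13.66 (2); Mumford §20 (3)).
[cite: GortzWedhorn2020, Prop. 13.50 (4) (p. 394) and Prop. 13.66 (2) (p. 402)] [cite: EGAII, Prop. 4.6.13 (iv)]
[cite: MumfordAV1970, §20 (property (3) of e_n, p. 186)] -/
theorem exists_isAmple_weilPairingLevel_eq_prod_of_biproduct {C : Type v} [Fintype C] [Nonempty C]
    (J : C → AbelianVariety K) (Y : AbelianVariety K) (π : ∀ c, Y ⟶ J c) (ι : ∀ c, J c ⟶ Y)
    (h₁ : ∀ c, ι c ≫ π c = 𝟙 (J c)) (h₂ : ∀ c c', c ≠ c' → ι c ≫ π c' = 0) (h₃ : ∑ c, π c ≫ ι c = 𝟙 Y)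
    (Θ : ∀ c, CartierDivisor (J c).X.left) (hΘ : ∀ c, (Θ c).IsAmple) :
    ∃ Θ' : CartierDivisor Y.X.left, Θ'.IsAmple ∧
      ∀ (N : ℕ) [IsDominant (Hom.toSchemeHom ((N : ℤ) • 𝟙 Y))]
        [∀ c, IsDominant (Hom.toSchemeHom ((N : ℤ) • 𝟙 (J c)))] (P Q : Y.torsionPoints K N),
        Y.weilPairingLevel Θ' P Q = ∏ c, (J c).weilPairingLevel (Θ c)
          ⟨AlgPoints.map (π c).hom.hom.hom P.1, map_mem_torsionPoints (π c) P.2⟩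
          ⟨AlgPoints.map (π c).hom.hom.hom Q.1, map_mem_torsionPoints (π c) Q.2⟩ := by
  classical
  obtain ⟨Y₀, π₀, ι₀, k₁, k₂, k₃, Θ₀, hΘ₀, hlaw₀⟩ := exists_biproduct_isAmple_weilPairingLevel_eq_prod J Θ hΘ
  set φ : Y ⟶ Y₀ := ∑ c, π c ≫ ι₀ c with hφ
  set ψ : Y₀ ⟶ Y := ∑ c, π₀ c ≫ ι c with hψ
  have hφψ : φ ≫ ψ = 𝟙 Y := by rw [hφ, hψ, biprodPres_sum_comp_sum π₀ ι₀ k₁ k₂, h₃]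
  have hψφ : ψ ≫ φ = 𝟙 Y₀ := by rw [hφ, hψ, biprodPres_sum_comp_sum π ι h₁ h₂, k₃]
  have hφπ : ∀ c, φ ≫ π₀ c = π c := fun c => by rw [hφ]; exact biprodPres_sum_comp_π π₀ ι₀ k₁ k₂ π c
  haveI : IsIso (Hom.toSchemeHom φ) := biprodPres_isIso_toSchemeHom ⟨φ, ψ, hφψ, hψφ⟩
  refine ⟨Θ₀.pullback (Hom.toSchemeHom φ), hΘ₀.pullback _, fun N _ hJ P Q => ?_⟩
  haveI : IsDominant (Hom.toSchemeHom ((N : ℤ) • 𝟙 Y₀)) := isDominant_toSchemeHom_zsmul_id_of_comp_eq_id φ ψ hψφ N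
  rw [weilPairingLevel_pullback, hlaw₀ N]
  refine Finset.prod_congr rfl fun c _ => ?_
  have hpt : ∀ R : Y.torsionPoints K N,
      (⟨AlgPoints.map (π₀ c).hom.hom.hom (AlgPoints.map φ.hom.hom.hom R.1),
          map_mem_torsionPoints (π₀ c) (map_mem_torsionPoints φ R.2)⟩ : (J c).torsionPoints K N) =
        ⟨AlgPoints.map (π c).hom.hom.hom R.1, map_mem_torsionPoints (π c) R.2⟩ := fun R =>
    Subtype.ext (by
      change AlgPoints.map (π₀ c).hom.hom.hom (AlgPoints.map φ.hom.hom.hom R.1) = AlgPoints.map (π c).hom.hom.hom R.1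
      rw [← biprodPres_map_comp_apply, hφπ c])
  rw [hpt P, hpt Q]

/-! ### §3 The legs `(π_c, ι_c)` are level-adjoint pairs of weight `1` for `(Θ', Θ_c)` -/

section Adjoint

variable {C : Type v} {J : C → AbelianVariety K} {Y : AbelianVariety K} (π : ∀ c, Y ⟶ J c) (ι : ∀ c, J c ⟶ Y)
  {N : ℕ}

/-- `π_c (ι_c Q) = Q` on `N`-torsion points. [folklore] -/
private theorem biprodPres_map_π_map_ι_self (h₁ : ∀ c, ι c ≫ π c = 𝟙 (J c)) (c : C)
    (Q : (J c).torsionPoints K N) :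
    (⟨AlgPoints.map (π c).hom.hom.hom (AlgPoints.map (ι c).hom.hom.hom Q.1),
      map_mem_torsionPoints (π c) (map_mem_torsionPoints (ι c) Q.2)⟩ : (J c).torsionPoints K N) = Q :=
  Subtype.ext (by
    change AlgPoints.map (π c).hom.hom.hom (AlgPoints.map (ι c).hom.hom.hom Q.1) = Q.1
    rw [← biprodPres_map_comp_apply, h₁ c, biprodPres_map_id_apply])

/-- `π_{c'} (ι_c Q) = 1` on `N`-torsion points for `c' ≠ c`. [folklore] -/
private theorem biprodPres_map_π_map_ι_ne (h₂ : ∀ c c', c ≠ c' → ι c ≫ π c' = 0) {c c' : C} (hc' : c' ≠ c)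
    (Q : (J c).torsionPoints K N) :
    (⟨AlgPoints.map (π c').hom.hom.hom (AlgPoints.map (ι c).hom.hom.hom Q.1),
      map_mem_torsionPoints (π c') (map_mem_torsionPoints (ι c) Q.2)⟩ : (J c').torsionPoints K N) = 1 :=
  Subtype.ext (by
    change AlgPoints.map (π c').hom.hom.hom (AlgPoints.map (ι c).hom.hom.hom Q.1) = (1 : (J c').Points K)
    rw [← biprodPres_map_comp_apply, h₂ c c' (Ne.symm hc'), biprodPres_map_zero_apply])

variable [Fintype C] (h₁ : ∀ c, ι c ≫ π c = 𝟙 (J c)) (h₂ : ∀ c c', c ≠ c' → ι c ≫ π c' = 0)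
  (Θ : ∀ c, CartierDivisor (J c).X.left) (Θ' : CartierDivisor Y.X.left)
  [IsDominant (Hom.toSchemeHom ((N : ℤ) • 𝟙 Y))] [∀ c, IsDominant (Hom.toSchemeHom ((N : ℤ) • 𝟙 (J c)))]
  (hlaw : ∀ P Q : Y.torsionPoints K N, Y.weilPairingLevel Θ' P Q = ∏ c, (J c).weilPairingLevel (Θ c)
    ⟨AlgPoints.map (π c).hom.hom.hom P.1, map_mem_torsionPoints (π c) P.2⟩
    ⟨AlgPoints.map (π c).hom.hom.hom Q.1, map_mem_torsionPoints (π c) Q.2⟩)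

include h₁ h₂ hlaw

/-- **`ē_N^{Θ'}(P, ι_c Q) = ē_N^{Θ_c}(π_c P, Q)`** — the legs `(π_c, ι_c)` of a biproduct presentation are a
level-adjoint pair of weight `1` for `(Θ', Θ_c)` whenever `Θ'` satisfies the product pairing law (at level `N`): in
`∏_{c'} ē^{Θ_{c'}}(π_{c'} P, π_{c'} ι_c Q)` the factor `c' = c` is `ē^{Θ_c}(π_c P, Q)` (`ι_c π_c = 1`) and the
others pair with the identity point (`ι_c π_{c'} = 0`; ★ `weilPairingLevel_one_right`). Mumford §20 (3) for the
product polarisation (Lange §2.1.1 / Ex. 2.6 (3)): the Rosati involution of `⊠ Θ_c` is computed leg by leg.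
[cite: MumfordAV1970, §20 (property (3) of e_n, p. 186)] [cite: Lang1983AbelianVarieties, Ch. VII §2 Prop. 3] -/
theorem weilPairingLevel_map_ι_right_of_prod_law (c : C) (P : Y.torsionPoints K N)
    (Q : (J c).torsionPoints K N) :
    Y.weilPairingLevel Θ' P ⟨AlgPoints.map (ι c).hom.hom.hom Q.1, map_mem_torsionPoints (ι c) Q.2⟩ =
      (J c).weilPairingLevel (Θ c) ⟨AlgPoints.map (π c).hom.hom.hom P.1, map_mem_torsionPoints (π c) P.2⟩ Q := by
  classical
  rw [hlaw, ← Finset.mul_prod_erase Finset.univ _ (Finset.mem_univ c), biprodPres_map_π_map_ι_self π ι h₁ c Q,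
    Finset.prod_eq_one (fun c' hc'' => by
      rw [biprodPres_map_π_map_ι_ne π ι h₂ (Finset.ne_of_mem_erase hc''), weilPairingLevel_one_right]), mul_one]

/-- **`ē_N^{Θ'}(ι_c Q, P) = ē_N^{Θ_c}(Q, π_c P)`** — the same adjointness with the arguments exchanged
(★ `weilPairingLevel_one_left` for the factors `c' ≠ c`). [cite: MumfordAV1970, §20 (property (3) of e_n, p. 186)]
[cite: Lang1983AbelianVarieties, Ch. VII §2 Prop. 3] -/
theorem weilPairingLevel_map_ι_left_of_prod_law (c : C) (Q : (J c).torsionPoints K N)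
    (P : Y.torsionPoints K N) :
    Y.weilPairingLevel Θ' ⟨AlgPoints.map (ι c).hom.hom.hom Q.1, map_mem_torsionPoints (ι c) Q.2⟩ P =
      (J c).weilPairingLevel (Θ c) Q ⟨AlgPoints.map (π c).hom.hom.hom P.1, map_mem_torsionPoints (π c) P.2⟩ := by
  classical
  rw [hlaw, ← Finset.mul_prod_erase Finset.univ _ (Finset.mem_univ c), biprodPres_map_π_map_ι_self π ι h₁ c Q,
    Finset.prod_eq_one (fun c' hc'' => by
      rw [biprodPres_map_π_map_ι_ne π ι h₂ (Finset.ne_of_mem_erase hc''), weilPairingLevel_one_left]), mul_one]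

end Adjoint

end AbelianVariety

end Literature.AlgebraicGeometry.Motives

end
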